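import Summits.SmoothPoincare4.SmoothPoincare4.Theses.EntropyRung
import Summits.SmoothPoincare4.SmoothPoincare4.Theorems.EntropyRungSubcylindricalExistenceCapFactor
import Literature.Geometry.Riemannian.PerelmanEntropyCutoff
import Literature.Geometry.Lorentzian.CurvatureSymmetries
import Mathlib.Analysis.SpecialFunctions.SmoothTransition
import Mathlib.Analysis.SpecialFunctions.Trigonometric.Deriv
import HarnessLib

/-!
# A logarithmic cut-off pair across a level annulus of a Green-type function
(stub `logCutoff_exists`, helper H6, line `green-blowup-conformal-entropy`, crux
`EntropyRung.SubcylindricalExistence`, item stmt-SmoothPoincare4-10871)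

**Statement (`logCutoff_exists`).** There is a universal constant `C > 0` such that on every
closed smooth 4-manifold `M` of the summit binder with a Riemannian metric `g`, for every point `p`,
every function `G` smooth and positive off `p` with `G → +∞` at `p`, and every `S > 1`, there are
smooth `χ₁, χ₂ : M → ℝ` with `χ₁² + χ₂² = 1`, `χ₁ = 1` on `{G ≤ S}`, `χ₁ = 0` on `{G ≥ S²} ∪ {p}`,
`|∇χ₁|² = |∇χ₂|² = 0` at `p`, and the logarithmic gradient bound
`|∇χ₁|² + |∇χ₂|² ≤ C (log S)⁻² · G⁻² |∇G|²` off `p`.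

**Construction.** With `η = Real.smoothTransition` (smooth, `0` on `(-∞, 0]`, `1` on `[1, ∞)`),
put `T_S(s) = η(log s / log S − 1)` (`= 0` for `|s| ≤ S`, `= 1` for `s ≥ S²`, smooth on all of `ℝ`
since it is locally constant near `0`), `Θ₁ = cos(π T_S / 2)`, `Θ₂ = sin(π T_S / 2)` and
`χᵢ = Θᵢ ∘ G` extended by `Θᵢ(S²)` at `p` (the `capProfile` shape of the landed helper H4, whose
smoothness / local-constancy lemmas `CapFactor.capProfile_*` are reused). The chain rule for the
gradient square (`gradSq_real_comp`) gives `|∇χ₁|² + |∇χ₂|² = (π/2)² η'(…)² (s log S)⁻² |∇G|²`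
at `s = G x`, and `η'` is bounded (continuous with support in `[0, 1]`), whence
`C = (π/2)² (sup |η'|)² + 1`. This is the standard logarithmic cut-off trick (the 4-d capacity of
the annulus `{S ≤ G ≤ S²}` is `O((log S)⁻²)`); it feeds the two-piece localisation of Perelman's
`𝒲`-functional (helper H1 `wEntropy_localisation_two`) in Stub D of the line. References:
Schoen–Yau 1979 §2 and Kobayashi 1987 §2 (logarithmic cut-offs around the pole of the Green
function); Perelman 2002 §3 (the `𝒲`-functional). [folklore]
-/

noncomputable section

-- the registered namespace `Summit.SmoothPoincare4.SmoothPoincare4.Theorems` repeats a component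
set_option linter.dupNamespace false

open scoped Manifold ContDiff Topology
open Set Filter
open Literature.Geometry.Lorentzian Literature.Geometry.Riemannian

namespace Summit.SmoothPoincare4.SmoothPoincare4.Theorems

namespace LogCutoff

/-! ### The smooth transition has a bounded derivative -/

/-- The derivative of `Real.smoothTransition` is bounded: it is continuous and vanishes off the
compact interval `[0, 1]`, where the transition is locally constant. -/
theorem exists_abs_deriv_smoothTransition_le : ∃ B : ℝ, ∀ y, |deriv Real.smoothTransition y| ≤ B := by
  have hc : Continuous (deriv Real.smoothTransition) :=
    Real.smoothTransition.contDiff.continuous_deriv (le_refl (1 : WithTop ℕ∞))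
  have hsupp : HasCompactSupport (deriv Real.smoothTransition) := by
    refine HasCompactSupport.intro (K := Icc 0 1) isCompact_Icc fun y hy ↦ ?_
    simp only [mem_Icc, not_and_or, not_le] at hy
    rcases hy with hy | hy
    · have h : Real.smoothTransition =ᶠ[𝓝 y] fun _ ↦ (0 : ℝ) := by
        filter_upwards [Iio_mem_nhds hy] with t ht using Real.smoothTransition.zero_of_nonpos (le_of_lt ht)
      rw [h.deriv_eq, deriv_const]
    · have h : Real.smoothTransition =ᶠ[𝓝 y] fun _ ↦ (1 : ℝ) := by
        filter_upwards [Ioi_mem_nhds hy] with t ht using Real.smoothTransition.one_of_one_le (le_of_lt ht)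
      rw [h.deriv_eq, deriv_const]
  obtain ⟨B, hB⟩ := hc.bounded_above_of_compact_support hsupp
  exact ⟨B, fun y ↦ by simpa only [Real.norm_eq_abs] using hB y⟩

/-! ### The logarithmic argument `log s / log S − 1` and the transition `T_S = η ∘ (·)` -/

variable {S : ℝ}

/-- `log s ≤ log S` for `|s| ≤ S` and `S > 1` (recall `log 0 = 0` and `log s = log |s|`). -/
theorem log_le_log_of_abs_le (hS : 1 < S) {s : ℝ} (hs : |s| ≤ S) : Real.log s ≤ Real.log S := by
  rcases eq_or_ne s 0 with rfl | h0
  · rw [Real.log_zero]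
    exact (Real.log_pos hS).le
  · rw [← Real.log_abs]
    exact Real.log_le_log (abs_pos.mpr h0) hs

/-- The logarithmic argument is `≤ 0` on `{|s| ≤ S}`. -/
theorem logArg_nonpos (hS : 1 < S) {s : ℝ} (hs : |s| ≤ S) : Real.log s / Real.log S - 1 ≤ 0 := by
  rw [sub_nonpos, div_le_one (Real.log_pos hS)]
  exact log_le_log_of_abs_le hS hs

/-- The logarithmic argument is `≥ 1` on `{S² ≤ s}`. -/
theorem one_le_logArg (hS : 1 < S) {s : ℝ} (hs : S ^ 2 ≤ s) : 1 ≤ Real.log s / Real.log S - 1 := by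
  have hL : 0 < Real.log S := Real.log_pos hS
  have h2 : 2 * Real.log S ≤ Real.log s := by
    have := Real.log_le_log (by positivity) hs
    rwa [Real.log_pow, Nat.cast_ofNat] at this
  rw [le_sub_iff_add_le, le_div_iff₀ hL]
  linarith

/-- The derivative of the logarithmic argument off `0`. -/
theorem hasDerivAt_logArg (S : ℝ) {s : ℝ} (hs : s ≠ 0) :
    HasDerivAt (fun t ↦ Real.log t / Real.log S - 1) (s⁻¹ / Real.log S) s :=
  ((Real.hasDerivAt_log hs).div_const _).sub_const 1

/-- The transition `T_S(s) = η(log s / log S − 1)` vanishes on `{|s| ≤ S}`. -/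
theorem transition_eq_zero (hS : 1 < S) {s : ℝ} (hs : |s| ≤ S) :
    Real.smoothTransition (Real.log s / Real.log S - 1) = 0 :=
  Real.smoothTransition.zero_of_nonpos (logArg_nonpos hS hs)

/-- The transition `T_S` is `1` on `{S² ≤ s}`. -/
theorem transition_eq_one (hS : 1 < S) {s : ℝ} (hs : S ^ 2 ≤ s) :
    Real.smoothTransition (Real.log s / Real.log S - 1) = 1 :=
  Real.smoothTransition.one_of_one_le (one_le_logArg hS hs)

/-- The transition `T_S` is smooth on all of `ℝ`: a composition of smooth maps off `0`, and
locally constant (`= 0` on the open set `{|s| < S}`) near `0`. -/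
theorem contDiff_transition (hS : 1 < S) :
    ContDiff ℝ ∞ (fun s ↦ Real.smoothTransition (Real.log s / Real.log S - 1)) := by
  refine contDiff_iff_contDiffAt.mpr fun s ↦ ?_
  rcases eq_or_ne s 0 with rfl | h0
  · have hev : (fun s ↦ Real.smoothTransition (Real.log s / Real.log S - 1)) =ᶠ[𝓝 (0 : ℝ)]
        fun _ ↦ (0 : ℝ) := by
      have hopen : IsOpen {t : ℝ | |t| < S} := isOpen_lt continuous_abs continuous_const
      filter_upwards [hopen.mem_nhds (show |(0 : ℝ)| < S by simpa using zero_lt_one.trans hS)] with t ht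
      exact transition_eq_zero hS (le_of_lt ht)
    exact contDiffAt_const.congr_of_eventuallyEq hev
  · exact Real.smoothTransition.contDiffAt.comp s
      (((Real.contDiffAt_log.mpr h0).div_const _).sub contDiffAt_const)

/-- The derivative of the transition `T_S` off `0` (chain rule). -/
theorem hasDerivAt_transition (S : ℝ) {s : ℝ} (hs : s ≠ 0) :
    HasDerivAt (fun t ↦ Real.smoothTransition (Real.log t / Real.log S - 1))
      (deriv Real.smoothTransition (Real.log s / Real.log S - 1) * (s⁻¹ / Real.log S)) s :=
  ((Real.smoothTransition.contDiff (n := ⊤)).differentiable (by simp)).differentiableAt.hasDerivAt.comp s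
    (hasDerivAt_logArg S hs)

/-! ### The one-variable profiles `Θ₁ = cos(π T_S / 2)`, `Θ₂ = sin(π T_S / 2)` -/

/-- **The real-variable cut-off pair.** A universal `C > 0` such that for every `S > 1` there are
smooth `Θ₁, Θ₂ : ℝ → ℝ` with `Θ₁² + Θ₂² = 1`, `Θ₁ = 1` on `{|s| ≤ S}`, `Θ₁ = 0` and `Θ₂ = 1` on
`{S² ≤ s}`, differentiable off `0` with `Θ₁'(s)² + Θ₂'(s)² ≤ C (log S)⁻² s⁻²`. -/
theorem profiles_exist : ∃ C : ℝ, 0 < C ∧ ∀ S : ℝ, 1 < S → ∃ θ₁ θ₂ θ₁' θ₂' : ℝ → ℝ,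
    ContDiff ℝ ∞ θ₁ ∧ ContDiff ℝ ∞ θ₂ ∧ (∀ s, θ₁ s ^ 2 + θ₂ s ^ 2 = 1) ∧ (∀ s, |s| ≤ S → θ₁ s = 1) ∧
    (∀ s, S ^ 2 ≤ s → θ₁ s = 0) ∧ (∀ s, S ^ 2 ≤ s → θ₂ s = 1) ∧
    (∀ s, s ≠ 0 → HasDerivAt θ₁ (θ₁' s) s) ∧ (∀ s, s ≠ 0 → HasDerivAt θ₂ (θ₂' s) s) ∧
    ∀ s, θ₁' s ^ 2 + θ₂' s ^ 2 ≤ C / Real.log S ^ 2 * s⁻¹ ^ 2 := by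
  obtain ⟨B, hB⟩ := exists_abs_deriv_smoothTransition_le
  refine ⟨(Real.pi / 2) ^ 2 * B ^ 2 + 1, by positivity, fun S hS ↦ ?_⟩
  have hT := contDiff_transition hS
  refine ⟨fun s ↦ Real.cos (Real.pi / 2 * Real.smoothTransition (Real.log s / Real.log S - 1)),
    fun s ↦ Real.sin (Real.pi / 2 * Real.smoothTransition (Real.log s / Real.log S - 1)),
    fun s ↦ -Real.sin (Real.pi / 2 * Real.smoothTransition (Real.log s / Real.log S - 1)) *
      (Real.pi / 2 * (deriv Real.smoothTransition (Real.log s / Real.log S - 1) * (s⁻¹ / Real.log S))),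
    fun s ↦ Real.cos (Real.pi / 2 * Real.smoothTransition (Real.log s / Real.log S - 1)) *
      (Real.pi / 2 * (deriv Real.smoothTransition (Real.log s / Real.log S - 1) * (s⁻¹ / Real.log S))),
    (contDiff_const.mul hT).cos, (contDiff_const.mul hT).sin, fun s ↦ Real.cos_sq_add_sin_sq _,
    fun s hs ↦ ?_, fun s hs ↦ ?_, fun s hs ↦ ?_, fun s hs ↦ ((hasDerivAt_transition S hs).const_mul _).cos,
    fun s hs ↦ ((hasDerivAt_transition S hs).const_mul _).sin, fun s ↦ ?_⟩
  · simp [transition_eq_zero hS hs]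
  · simp [transition_eq_one hS hs]
  · simp [transition_eq_one hS hs]
  · set D := deriv Real.smoothTransition (Real.log s / Real.log S - 1) with hD
    set a := Real.pi / 2 * Real.smoothTransition (Real.log s / Real.log S - 1) with ha
    have hDB : D ^ 2 ≤ B ^ 2 := by
      rw [← sq_abs D]
      exact pow_le_pow_left₀ (abs_nonneg D) (hB _) 2
    have hC : (Real.pi / 2) ^ 2 * D ^ 2 ≤ (Real.pi / 2) ^ 2 * B ^ 2 + 1 := by
      have := mul_le_mul_of_nonneg_left hDB (sq_nonneg (Real.pi / 2))
      linarith
    have hX : ∀ X : ℝ, (-Real.sin a * X) ^ 2 + (Real.cos a * X) ^ 2 = X ^ 2 := fun X ↦ by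
      calc (-Real.sin a * X) ^ 2 + (Real.cos a * X) ^ 2
          = X ^ 2 * (Real.sin a ^ 2 + Real.cos a ^ 2) := by ring
        _ = X ^ 2 := by rw [Real.sin_sq_add_cos_sq, mul_one]
    rw [hX]
    calc (Real.pi / 2 * (D * (s⁻¹ / Real.log S))) ^ 2
        = (Real.pi / 2) ^ 2 * D ^ 2 * (s⁻¹ ^ 2 / Real.log S ^ 2) := by ring
      _ ≤ ((Real.pi / 2) ^ 2 * B ^ 2 + 1) * (s⁻¹ ^ 2 / Real.log S ^ 2) :=
          mul_le_mul_of_nonneg_right hC (by positivity)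
      _ = ((Real.pi / 2) ^ 2 * B ^ 2 + 1) / Real.log S ^ 2 * s⁻¹ ^ 2 := by ring

/-! ### The manifold part: gradient squares of the extended profile `θ ∘ G` -/

section Manifold

open scoped Classical

variable {M : Type} [TopologicalSpace M] [ChartedSpace (EuclideanSpace ℝ (Fin 4)) M] [IsManifold (𝓡 4) ∞ M]
  (g : PseudoRiemannianMetric (𝓡 4) ∞ (EuclideanSpace ℝ (Fin 4)) (TangentSpace (𝓡 4) : M → Type _))
  {p : M} {G : M → ℝ} {θ : ℝ → ℝ}

/-- The gradient square only depends on the germ of the function. -/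
theorem gradSq_congr_of_eventuallyEq {f f' : M → ℝ} {x : M} (h : f =ᶠ[𝓝 x] f') :
    g.gradSq f x = g.gradSq f' x := by
  simp only [PseudoRiemannianMetric.gradSq, mvfderiv_congr_of_eventuallyEq h]

/-- At the pole the extended profile `x ↦ if x = p then θ S else θ (G x)` is locally constant
(`G → +∞` at `p`, `θ` constant on `[S, ∞)`), so its gradient square vanishes there. -/
theorem gradSq_capProfile_pole {S : ℝ} (hGlim : Tendsto G (𝓝[≠] p) atTop)
    (hθS : ∀ s, S ≤ s → θ s = θ S) :
    g.gradSq (fun x : M ↦ if x = p then θ S else θ (G x)) p = 0 := by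
  apply g.gradSq_eq_zero_of_mvfderiv_eq_zero
  rw [mvfderiv_congr_of_eventuallyEq
    (CapFactor.capProfile_eventuallyEq_const (G := G) (θ := θ) (S := S) hGlim hθS), mvfderiv_const]

/-- Off the pole, `|∇(θ ∘ G)|²(x) = θ'(G x)² |∇G|²(x)` for the extended profile (chain rule
`gradSq_real_comp`; the extension agrees with `θ ∘ G` near `x ≠ p`). -/
theorem gradSq_capProfile [T2Space M] (c : ℝ) (hGs : ContMDiffOn (𝓡 4) 𝓘(ℝ, ℝ) ∞ G {p}ᶜ) {x : M}
    (hx : x ≠ p) {θ' : ℝ} (hθ : HasDerivAt θ θ' (G x)) :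
    g.gradSq (fun y : M ↦ if y = p then c else θ (G y)) x = θ' ^ 2 * g.gradSq G x := by
  have hG : MDifferentiableAt (𝓡 4) 𝓘(ℝ, ℝ) G x :=
    ((hGs x (by simpa using hx)).contMDiffAt (isOpen_compl_singleton.mem_nhds (by simpa using hx))).mdifferentiableAt
      (by simp)
  have hev : (fun y : M ↦ if y = p then c else θ (G y)) =ᶠ[𝓝 x] (θ ∘ G) := by
    filter_upwards [isOpen_compl_singleton.mem_nhds (show x ∈ ({p}ᶜ : Set M) by simpa using hx)] with y hy
    have hyp : y ≠ p := by simpa using hy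
    simp [hyp]
  rw [gradSq_congr_of_eventuallyEq g hev]
  exact g.gradSq_real_comp hθ hG

end Manifold

end LogCutoff

section Main

open scoped Classical

/-- **Helper H6 (registered stub `logCutoff_exists`) — a logarithmic cut-off pair across the
level annulus `{S ≤ G ≤ S²}` of a Green-type function.** There is a universal `C > 0` such that
for every Riemannian `g` on a closed smooth 4-manifold of the summit binder, every `p`, every `G`
smooth and positive off `p` with `G → +∞` at `p`, and every `S > 1`, there are smooth `χ₁, χ₂` with
`χ₁² + χ₂² = 1`, `χ₁ = 1` on `{G ≤ S} ∖ {p}`, `χ₁ = 0` on `{G ≥ S²} ∪ {p}`,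
`|∇χ₁|² + |∇χ₂|² ≤ C (log S)⁻² G⁻² |∇G|²` off `p`, and `|∇χ₁|² = |∇χ₂|² = 0` at `p`
(`χᵢ = Θᵢ ∘ G` with the profiles of `LogCutoff.profiles_exist`). Standard logarithmic cut-off
(Schoen–Yau 1979 §2, Kobayashi 1987 §2); see the module docstring. -/
theorem logCutoff_exists :
    ∃ C : ℝ, 0 < C ∧ ∀ (M : Type) [TopologicalSpace M] [T2Space M] [SecondCountableTopology M]
      [ChartedSpace (EuclideanSpace ℝ (Fin 4)) M] [IsManifold (𝓡 4) ∞ M] [CompactSpace M]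
      [T3Space M] [MeasurableSpace M] [BorelSpace M]
      (g : PseudoRiemannianMetric (𝓡 4) ∞ (EuclideanSpace ℝ (Fin 4)) (TangentSpace (𝓡 4) : M → Type _)),
      g.IsRiemannian → ∀ (p : M) (G : M → ℝ), ContMDiffOn (𝓡 4) 𝓘(ℝ, ℝ) ∞ G {p}ᶜ → (∀ x, x ≠ p → 0 < G x) →
      Tendsto G (𝓝[≠] p) atTop → ∀ S : ℝ, 1 < S →
      ∃ χ₁ χ₂ : M → ℝ, ContMDiff (𝓡 4) 𝓘(ℝ, ℝ) ∞ χ₁ ∧ ContMDiff (𝓡 4) 𝓘(ℝ, ℝ) ∞ χ₂ ∧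
        (∀ x, χ₁ x ^ 2 + χ₂ x ^ 2 = 1) ∧ (∀ x, x ≠ p → G x ≤ S → χ₁ x = 1) ∧
        (∀ x, x ≠ p → S ^ 2 ≤ G x → χ₁ x = 0) ∧ χ₁ p = 0 ∧
        (∀ x, x ≠ p → g.gradSq χ₁ x + g.gradSq χ₂ x ≤ C / Real.log S ^ 2 * ((G x)⁻¹ ^ 2 * g.gradSq G x)) ∧
        g.gradSq χ₁ p = 0 ∧ g.gradSq χ₂ p = 0 := by
  obtain ⟨C, hC, hprof⟩ := LogCutoff.profiles_exist
  refine ⟨C, hC, ?_⟩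
  intro M _ _ _ _ _ _ _ _ _ g hg p G hGs hGpos hGlim S hS
  obtain ⟨θ₁, θ₂, θ₁', θ₂', hθ₁, hθ₂, hsq, hθ₁one, hθ₁zero, hθ₂one, hd₁, hd₂, hbound⟩ := hprof S hS
  have hθ₁S : ∀ s, S ^ 2 ≤ s → θ₁ s = θ₁ (S ^ 2) := fun s hs ↦ by rw [hθ₁zero s hs, hθ₁zero _ le_rfl]
  have hθ₂S : ∀ s, S ^ 2 ≤ s → θ₂ s = θ₂ (S ^ 2) := fun s hs ↦ by rw [hθ₂one s hs, hθ₂one _ le_rfl]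
  refine ⟨fun x ↦ if x = p then θ₁ (S ^ 2) else θ₁ (G x), fun x ↦ if x = p then θ₂ (S ^ 2) else θ₂ (G x),
    CapFactor.capProfile_contMDiff (θ := θ₁) (S := S ^ 2) hGs hGlim hθ₁ hθ₁S,
    CapFactor.capProfile_contMDiff (θ := θ₂) (S := S ^ 2) hGs hGlim hθ₂ hθ₂S,
    fun x ↦ ?_, fun x hx hGx ↦ ?_, fun x hx hGx ↦ ?_, ?_, fun x hx ↦ ?_,
    LogCutoff.gradSq_capProfile_pole g hGlim hθ₁S, LogCutoff.gradSq_capProfile_pole g hGlim hθ₂S⟩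
  · by_cases hx : x = p <;> simp [hx, hsq]
  · simpa [hx] using hθ₁one (G x) (by rwa [abs_of_pos (hGpos x hx)])
  · simpa [hx] using hθ₁zero (G x) hGx
  · simpa using hθ₁zero (S ^ 2) le_rfl
  · rw [LogCutoff.gradSq_capProfile g (θ₁ (S ^ 2)) hGs hx (hd₁ _ (hGpos x hx).ne'),
      LogCutoff.gradSq_capProfile g (θ₂ (S ^ 2)) hGs hx (hd₂ _ (hGpos x hx).ne')]
    have h0 : 0 ≤ g.gradSq G x := g.gradSq_nonneg hg G x
    calc θ₁' (G x) ^ 2 * g.gradSq G x + θ₂' (G x) ^ 2 * g.gradSq G x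
        = (θ₁' (G x) ^ 2 + θ₂' (G x) ^ 2) * g.gradSq G x := by ring
      _ ≤ C / Real.log S ^ 2 * (G x)⁻¹ ^ 2 * g.gradSq G x := mul_le_mul_of_nonneg_right (hbound (G x)) h0
      _ = C / Real.log S ^ 2 * ((G x)⁻¹ ^ 2 * g.gradSq G x) := by ring

end Main

end Summit.SmoothPoincare4.SmoothPoincare4.Theorems

end
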